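import Literature.MathematicalPhysics.QuantumLattice.MPSCoarseGrainingSectors
import HarnessLib

/-!
# Charge sectors of the coarse-grained window variables for SITE-INDEXED (e.g. staggered) charges

`MPSCoarseGrainingSectors` treats an MPS tensor that is covariant for a translation-invariant additive charge
(`A^s_{ab} ≠ 0 ⇒ qb b = qb a + q s`). A one-site-cell MPS can also be covariant for a charge whose local density
ALTERNATES with the sublattice — the staggered magnetisation `Σ_x (−1)^x S^z_x` of a Néel-type tensor, or, after the
odd-site spin rotation used for the Hubbard chain, the physical `S^z_tot` itself — and then the covariance rule on the
bonds is an INVOLUTION, `u_b = κ − u_a − m(s)`, not an addition [cite: PerezGarciaVerstraeteWolfCirac2007, §3.2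
(symmetries of MPS: `u_g ⊗ V_g A V_g† = A` up to a phase, the virtual representation may differ from bond to bond)].
Both cases are covered by letting the bond-charge assignment and the site charge depend on the absolute POSITION:
`qb : ℕ → β → G`, `qs : ℕ → σ → G` with `A^s_{ab} ≠ 0 ⇒ qb (x+1) b = qb x a + qs x s` for every position `x`
(`covariantAt`); the involutive rule is the case `qb x a = (−1)^x (2 u_a − κ)`, `qs x s = (−1)^x · 2 m(s)`
(`covariantAt_of_involutive`). Then every word starting at position `x` is covariant with the position-weighted total
charge `Σ_i qs (x+i) (t_i)` (`qb_eq_of_word_apply_ne_zero_at`), and if the `(k+2)`-site window variable `ρ` placed at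
position `x` is block diagonal in `Σ_i qs (x+i) (u_i)` (for the staggered charge: the alternating sum
`Σ_i (−1)^{x+i} 2 m(u_i)`), the compressed variable `C_k(ρ)` is block diagonal for the site-indexed tags
`tagAt(s_L,(a,b),s_R) = qs x s_L + (qb (x+1+k) b − qb (x+1) a) + qs (x+1+k) s_R` (`cgState_apply_eq_zero_of_cgTagAt_ne`)
— the sector structure that the `mps-rawlow` relaxations with staggered charge components (sr-mbsolver FORMAT-ksdn v0.6,
'staggered charge components' R1–R3: block value = alternating sum anchored at the first site, `ω_m` tag with the parity
of `m`) impose on `ω_m`, shown here to hold at the TRUE marginals. The translation-invariant case is recovered by constant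
families (`cgTagAt_const`). Theorem-only apart from the tag `cgTagAt`; no `sorry`, no new axiom, no named fact.
[cite: KullEtAl2024, §2.5, §3.3 (symmetries of the relaxation; sectors of `ω^{(m)}`)]
[cite: PerezGarciaVerstraeteWolfCirac2007, §3.2 (symmetric MPS tensors)]
-/

noncomputable section

namespace Literature.MathematicalPhysics.QuantumLattice

open Matrix Finset
open scoped ComplexOrder BigOperators Kronecker

namespace MPSCoarseGraining

section CovarianceAt

variable {σ β G : Type*} [Fintype β] [DecidableEq β] [AddCommGroup G]

/-- **Words of a tensor covariant under site-indexed charges are covariant** with the position-weighted total charge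
of the word: if `A^s_{ab} ≠ 0 ⇒ qb (x+1) b = qb x a + qs x s` at every position `x`, then for a `k`-letter word read
from position `x`, `(A^{t₀}⋯A^{t_{k−1}})_{ab} ≠ 0 ⇒ qb (x+k) b = qb x a + Σ_i qs (x+i) (t_i)`.
[cite: KullEtAl2024, §3.3] [cite: PerezGarciaVerstraeteWolfCirac2007, §3.2] -/
theorem qb_eq_of_word_apply_ne_zero_at {A : σ → Matrix β β ℂ} {qs : ℕ → σ → G} {qb : ℕ → β → G}
    (hA : ∀ x s a b, A s a b ≠ 0 → qb (x + 1) b = qb x a + qs x s) :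
    ∀ {k : ℕ} (x : ℕ) (t : Fin k → σ) (a b : β), word A t a b ≠ 0 →
      qb (x + k) b = qb x a + ∑ i : Fin k, qs (x + (i : ℕ)) (t i) := by
  intro k
  induction k with
  | zero =>
    intro x t a b h
    rw [word_zero, Matrix.one_apply] at h
    by_cases hab : a = b
    · subst hab; simp
    · exact absurd (if_neg hab) h
  | succ k ih =>
    intro x t a b h
    rw [word_succ, Matrix.mul_apply] at h
    obtain ⟨c, -, hc⟩ := Finset.exists_ne_zero_of_sum_ne_zero h
    have h1 : A (t 0) a c ≠ 0 := left_ne_zero_of_mul hc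
    have h2 : word A (Fin.tail t) c b ≠ 0 := right_ne_zero_of_mul hc
    have h3 := ih (x + 1) (Fin.tail t) c b h2
    rw [show x + (k + 1) = x + 1 + k by omega, h3, hA _ _ _ _ h1, Fin.sum_univ_succ, add_assoc]
    congr 1
    congr 1
    refine Finset.sum_congr rfl fun i _ => ?_
    rw [Fin.val_succ, show x + ((i : ℕ) + 1) = x + 1 + (i : ℕ) by omega]
    rfl

/-- Hence `(W_k)_{(a,b),t} ≠ 0 ⇒ qb (x+k) b − qb x a = Σ_i qs (x+i) (t_i)` for the coarse-graining map read from position `x`.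
[cite: KullEtAl2024, §2.5, §3.3] -/
theorem sub_eq_of_cgMap_apply_ne_zero_at {A : σ → Matrix β β ℂ} {qs : ℕ → σ → G} {qb : ℕ → β → G}
    (hA : ∀ x s a b, A s a b ≠ 0 → qb (x + 1) b = qb x a + qs x s)
    {k : ℕ} (x : ℕ) (ab : β × β) (t : Fin k → σ) (h : cgMap A k ab t ≠ 0) :
    qb (x + k) ab.2 - qb x ab.1 = ∑ i : Fin k, qs (x + (i : ℕ)) (t i) := by
  rw [cgMap_apply] at h
  rw [qb_eq_of_word_apply_ne_zero_at hA x t ab.1 ab.2 h, add_sub_cancel_left]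

omit [Fintype β] [DecidableEq β] in
/-- A translation-invariant covariance rule is a site-indexed one with constant families. [cite: KullEtAl2024, §3.3] -/
theorem covariantAt_of_covariant {A : σ → Matrix β β ℂ} {q : σ → G} {qb : β → G}
    (hA : ∀ s a b, A s a b ≠ 0 → qb b = qb a + q s) :
    ∀ (x : ℕ) s a b, A s a b ≠ 0 → (fun _ : ℕ => qb) (x + 1) b = (fun _ : ℕ => qb) x a + (fun _ : ℕ => q) x s :=
  fun _ s a b h => hA s a b h

omit [Fintype β] [DecidableEq β] in
/-- **The involutive (staggered) bond rule is a site-indexed additive covariance.** If `A^s_{ab} ≠ 0 ⇒ u_b = κ − u_a − m(s)`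
(the virtual charge flips sign across every tensor: a sublattice-alternating U(1) such as the staggered magnetisation
of a one-site-cell MPS), then with `qb x a = (−1)^x (2 u_a − κ)` and `qs x s = (−1)^x · 2 m(s)` the additive rule
`qb (x+1) b = qb x a + qs x s` holds at every position. [cite: PerezGarciaVerstraeteWolfCirac2007, §3.2] -/
theorem covariantAt_of_involutive {A : σ → Matrix β β ℂ} (u : β → ℤ) (m : σ → ℤ) (κ : ℤ)
    (hA : ∀ s a b, A s a b ≠ 0 → u b = κ - u a - m s) :
    ∀ (x : ℕ) s a b, A s a b ≠ 0 →
      (-1 : ℤ) ^ (x + 1) * (2 * u b - κ) = (-1 : ℤ) ^ x * (2 * u a - κ) + (-1 : ℤ) ^ x * (2 * m s) := by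
  intro x s a b h
  rw [hA s a b h, pow_succ]
  ring

omit [Fintype β] [DecidableEq β] in
/-- Componentwise site-indexed covariance for two charges gives covariance for the PAIR charge in `G × G'` (e.g. particle
number together with the staggered magnetisation). [cite: KullEtAl2024, §3.3] -/
theorem covariantAt_prod {G' : Type*} [AddCommGroup G'] {A : σ → Matrix β β ℂ}
    {qs : ℕ → σ → G} {qb : ℕ → β → G} {qs' : ℕ → σ → G'} {qb' : ℕ → β → G'}
    (hA : ∀ x s a b, A s a b ≠ 0 → qb (x + 1) b = qb x a + qs x s)
    (hA' : ∀ x s a b, A s a b ≠ 0 → qb' (x + 1) b = qb' x a + qs' x s) :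
    ∀ (x : ℕ) s a b, A s a b ≠ 0 →
      (fun x a => (qb x a, qb' x a)) (x + 1) b = (fun x a => (qb x a, qb' x a)) x a + (fun x s => (qs x s, qs' x s)) x s :=
  fun x s a b h => Prod.ext (hA x s a b h) (hA' x s a b h)

end CovarianceAt

section SectorsAt

variable {β G : Type*} [Fintype β] [DecidableEq β] [AddCommGroup G] {q : ℕ}

/-- **The site-indexed sector tag of a coarse-grained index** of a `(k+2)`-site window placed at position `x`:
`(s_L, (a,b), s_R) ↦ qs x s_L + (qb (x+1+k) b − qb (x+1) a) + qs (x+1+k) s_R` (left edge site at `x`, the coarse-grained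
block on sites `x+1 … x+k` between bonds `x+1` and `x+1+k`, right edge site at `x+1+k`). For the staggered charge this is
the parity-of-the-level tag of FORMAT-ksdn v0.6 R3. [cite: KullEtAl2024, §3.3] -/
def cgTagAt (qs : ℕ → Fin q → G) (qb : ℕ → β → G) (x k : ℕ) (i : Fin q × ((β × β) × Fin q)) : G :=
  qs x i.1 + (qb (x + 1 + k) i.2.1.2 - qb (x + 1) i.2.1.1) + qs (x + 1 + k) i.2.2

omit [Fintype β] [DecidableEq β] in
/-- Unfolding `cgTagAt`. [cite: KullEtAl2024, §3.3] -/
theorem cgTagAt_apply (qs : ℕ → Fin q → G) (qb : ℕ → β → G) (x k : ℕ) (i : Fin q × ((β × β) × Fin q)) :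
    cgTagAt qs qb x k i = qs x i.1 + (qb (x + 1 + k) i.2.1.2 - qb (x + 1) i.2.1.1) + qs (x + 1 + k) i.2.2 := rfl

omit [Fintype β] [DecidableEq β] in
/-- Constant families give back the translation-invariant tag `cgTag`. [cite: KullEtAl2024, §3.3] -/
theorem cgTagAt_const (qs : Fin q → G) (qb : β → G) (x k : ℕ) :
    cgTagAt (fun _ => qs) (fun _ => qb) x k = cgTag qs qb := by
  funext i
  rfl

/-- The position-weighted total charge of a window configuration read in the three-leg coordinates:
`Σ_i qs (x+i) (cons s_L (snoc t s_R))_i = qs x s_L + Σ_i qs (x+1+i) (t_i) + qs (x+1+k) s_R`. [cite: KullEtAl2024, §2.3] -/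
theorem sum_chargeAt_windowSplit3 (qs : ℕ → Fin q → G) (x : ℕ) {k : ℕ} (y : Fin q × ((Fin k → Fin q) × Fin q)) :
    ∑ i : Fin (k + 2), qs (x + (i : ℕ)) (windowSplit3 k q y i) =
      qs x y.1 + ∑ i : Fin k, qs (x + 1 + (i : ℕ)) (y.2.1 i) + qs (x + 1 + k) y.2.2 := by
  obtain ⟨sL, t, sR⟩ := y
  rw [windowSplit3_apply, Fin.sum_univ_succ, Fin.cons_zero, Fin.sum_univ_castSucc]
  simp only [Fin.cons_succ, Fin.snoc_castSucc, Fin.snoc_last, Fin.val_zero, add_zero, Fin.val_succ,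
    Fin.val_castSucc, Fin.val_last]
  rw [add_assoc]
  congr 1
  congr 1
  · refine Finset.sum_congr rfl fun i _ => ?_
    rw [show x + ((i : ℕ) + 1) = x + 1 + (i : ℕ) by omega]
  · rw [show x + (k + 1) = x + 1 + k by omega]

/-- **The compressed variable inherits the site-indexed charge sectors.** If `A` is covariant for site-indexed charges
and the `(k+2)`-site window variable `ρ` placed at position `x` is block diagonal in the position-weighted total charge
`Σ_i qs (x+i) (u_i)`, then `C_k(ρ)_{ij} = 0` whenever `tagAt i ≠ tagAt j`. [cite: KullEtAl2024, §3.3 (symmetry sectors of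
the relaxation variables)] [cite: PerezGarciaVerstraeteWolfCirac2007, §3.2] -/
theorem cgState_apply_eq_zero_of_cgTagAt_ne {A : Fin q → Matrix β β ℂ} {qs : ℕ → Fin q → G} {qb : ℕ → β → G}
    (hA : ∀ x s a b, A s a b ≠ 0 → qb (x + 1) b = qb x a + qs x s) (x k : ℕ) {ρ : Op (Fin (k + 2)) q}
    (hρ : ∀ u v : TensorIndex (Fin (k + 2)) q,
      ∑ i : Fin (k + 2), qs (x + (i : ℕ)) (u i) ≠ ∑ i : Fin (k + 2), qs (x + (i : ℕ)) (v i) → ρ u v = 0)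
    (i j : Fin q × ((β × β) × Fin q)) (hij : cgTagAt qs qb x k i ≠ cgTagAt qs qb x k j) : cgState A k ρ i j = 0 := by
  rw [cgState, Matrix.mul_apply]
  refine Finset.sum_eq_zero fun y _ => ?_
  rw [Matrix.mul_apply, Finset.sum_mul]
  refine Finset.sum_eq_zero fun z _ => ?_
  by_cases hz : ((1 : Matrix (Fin q) (Fin q) ℂ) ⊗ₖ (cgMap A k ⊗ₖ (1 : Matrix (Fin q) (Fin q) ℂ))) i z = 0
  · rw [hz, zero_mul, zero_mul]
  by_cases hy : ((1 : Matrix (Fin q) (Fin q) ℂ) ⊗ₖ (cgMap A k ⊗ₖ (1 : Matrix (Fin q) (Fin q) ℂ))) j y = 0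
  · rw [Matrix.conjTranspose_apply, hy, star_zero, mul_zero]
  -- a nonzero entry of `𝟙 ⊗ W ⊗ 𝟙` pins the edge sites and makes the word charge the bond-charge difference
  have key : ∀ (l : Fin q × ((β × β) × Fin q)) (w : Fin q × ((Fin k → Fin q) × Fin q)),
      ((1 : Matrix (Fin q) (Fin q) ℂ) ⊗ₖ (cgMap A k ⊗ₖ (1 : Matrix (Fin q) (Fin q) ℂ))) l w ≠ 0 →
        cgTagAt qs qb x k l = ∑ i : Fin (k + 2), qs (x + (i : ℕ)) (windowSplit3 k q w i) := by
    rintro ⟨sL, ab, sR⟩ ⟨u, t, w⟩ h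
    rw [Matrix.kroneckerMap_apply, Matrix.kroneckerMap_apply, Matrix.one_apply, Matrix.one_apply] at h
    have h1 : sL = u := by by_contra hne; exact h (by rw [if_neg hne, zero_mul])
    have h3 : sR = w := by by_contra hne; exact h (by rw [if_neg hne, mul_zero, mul_zero])
    have h2 : cgMap A k ab t ≠ 0 := fun h0 => h (by rw [h0, zero_mul, mul_zero])
    have h4 := sub_eq_of_cgMap_apply_ne_zero_at hA (x + 1) ab t h2
    rw [sum_chargeAt_windowSplit3, cgTagAt, h4, h1, h3]
  have hzy : ρ.submatrix (windowSplit3 k q) (windowSplit3 k q) z y = 0 := by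
    rw [Matrix.submatrix_apply]
    refine hρ _ _ fun heq => hij ?_
    rw [key i z hz, key j y hy, heq]
  rw [hzy, mul_zero, zero_mul]

end SectorsAt

end MPSCoarseGraining

end Literature.MathematicalPhysics.QuantumLattice

end
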